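import Summits.QuantumFields.GaugeBoot.ZdCentralTwistWords
import Summits.QuantumFields.GaugeBoot.ZdCentralTwistLimitPoints
import Summits.QuantumFields.GaugeBoot.ZdCentralTwistStates
import Summits.QuantumFields.GaugeBoot.ClassBLimitLinkCutWordBlocks
import Summits.QuantumFields.GaugeBoot.EvenTorusLimitLinkRP
import HarnessLib

/-!
# The Kazakov–Zheng cut-loop `R_link` blocks of even-side limit points at NEGATIVE coupling hold
# up to an explicit, factorising sign (gauge-boot, Class-B brick; `ℤ^d` twist on words 2/2)

HONEST FRAMING (cell `pub-gaugeboot`, page 1 of every file): the venture produces certified bounds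
on lattice expectations at stated coupling, gauge group, dimension and torus size; NOT a mass gap,
NOT a continuum limit, NOT a string tension; NOT Yang–Mills-summit-bearing (barriers
`FixedCouplingUltralocality`, `PerturbativeInvisibility`). Structural bookkeeping (which SDP blocks
are exact, with which sign, for which infinite-volume states); certifies no number; no certificate
of the cell sits at `β < 0`.

## Content

`ClassBLimitLinkCutWordBlocks.lean` (gen 68): for `β ≥ 0` and every torus limit point `ν`, the
cut-loop `R_link` block indexed by half-words `O_a : p + e_i → q + e_i` (`p_i = q_i = 0`), with
entries `B_ab = ∫ W_p([+e_i] · O_b · [-e_i] · (flip_i O_a)⁻¹) dν`, is positive semidefinite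
(covariant link RP). `CovariantLinkRPNegativeCoupling.lean` (gen 69): at `β < 0` covariant link RP
FAILS for every limit point (the `1 × 1` block, the plaquette, is negative). This module says what
survives at `β < 0` for gauge groups with a central involution `z`, `ρ z = -1` (`SU(2)`, `SU(2n)`,
`U(N)` fundamental): an even-side limit point `μ` at `β ≤ 0` is the twist `ν ∘ T⁻¹` of an even-side
limit point `ν` at `-β ≥ 0` (`ZdCentralTwistLimitPoints.lean`), `ν` IS covariantly link-RP, and the
twist multiplies the entry `B_ab` by the sign `(-1)^{c(p,i) + c(q,i)} · s_a · s_b`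
(`ZdCentralTwistWords.twistParityZd_linkCutGlue`: the Kogut–Susskind parity of the cut-glued loop
with the axis `i` last FACTORISES over the block indices). Hence:

* `neg_one_pow_val_mul_self`, `neg_one_pow_val_eq` (signs on `ℤ/2`);
* ★★ **`rLinkCutWordBlock_twisted_nonneg`** — for every probability measure `ν` with
  `IsCovariantLinkRP i ν` and the twisted state `μ = ν ∘ T⁻¹`, `T = centralTwist (stagTwist π i z)`:
  `0 ≤ (-1)^{c(p,i) + c(q,i)} · Σ_{ab} c_a c_b ∫ W_p(E_ab) dμ` (real `c`; decidable half-word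
  hypotheses `Word.zdLinkHalfOK`);
* ★★★ **`rLinkCutWordBlock_signed_nonneg_of_isInfiniteVolumeLimitAlong_even`** — `G : Type`
  compact Hausdorff second countable, `z` central with `z² = 1`, `ρ` continuous with `ρ z = -1`,
  `β ≤ 0`, `μ` the limit of the torus Wilson states along EVEN sizes (strictly increasing): for every
  axis `i`, sites `p, q` of the layer `x_i = 0`, half-words `O_a : p + e_i → q + e_i` in `{x_i ≥ 1}`
  and real `c`,
  `0 ≤ (-1)^{(Σ_{m ≠ i} p_m + Σ_{m ≠ i} q_m) mod 2} · Σ_{ab} c_a c_b ∫ W_p(E_ab) dμ`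
  — **the cut-loop `R_link` block is positive semidefinite when the transverse parities of `p` and
  `q` agree and NEGATIVE semidefinite when they differ** (`…_nonneg_of_even`, `…_nonpos_of_odd`);
  the `1 × 1` block of `O = [+e_k]` (`q = p + e_k`, odd) is the plaquette: `∫ W_p(P_{ik}) dμ ≤ 0`,
  consistent with the DLR sign rule; `_suEven` / `_uN` forms.

So at `β < 0` the even-side `SU(2n)` / `U(N)` limit states satisfy Kazakov–Zheng's link-type
positivity conditions EXACTLY after the sign change `B ↦ ε(p,q) D B D` (`D = diag(s_a)`,
`ε(p,q) = (-1)^{Σ_{m≠i}(p_m+q_m)}`) — a bookkeeping rule for a binder, not a new certificate.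

What this does NOT say: nothing for `SU(2n+1)` (no central involution with `ρ z = -1`); nothing
about limit points along odd sizes; nothing about the plain Class T / Class B structures; no number.

Elementary; [folklore] bookkeeping (Kogut–Susskind 1975; Li–Meurice, Phys. Rev. D 71 (2005)
016008 §II; cut loops: Kazakov–Zheng arXiv:2203.11360 §3.1).
-/

noncomputable section

open MeasureTheory Filter Topology
open scoped ComplexOrder ComplexConjugate
open Literature.Probability.LatticeModels (Site)
open Literature.MathematicalPhysics.QuantumLattice

namespace Summit.QuantumFields.GaugeBoot

namespace TiltedRP

variable {d N : ℕ}

/-! ## Signs -/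

section Signs

/-- `(-1)^{a.val} (-1)^{a.val} = 1`. -/
theorem neg_one_pow_val_mul_self (a : ZMod 2) : (-1 : ℝ) ^ a.val * (-1) ^ a.val = 1 := by
  rw [← pow_add, ← two_mul, pow_mul, neg_one_sq, one_pow]

/-- `(-1)^{a.val} = 1` for `a = 0` and `= -1` for `a = 1`. -/
theorem neg_one_pow_val_eq (a : ZMod 2) :
    (-1 : ℝ) ^ a.val = if a = 0 then 1 else -1 := by
  have ha : a = 0 ∨ a = 1 := by decide +revert
  rcases ha with rfl | rfl
  · simp
  · have h1 : (1 : ZMod 2).val = 1 := rfl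
    rw [h1, pow_one, if_neg (by decide)]

end Signs

/-! ## The twisted block from a covariantly link-RP state -/

section Twisted

variable {G : Type*} [Group G] [TopologicalSpace G] [IsTopologicalGroup G] [CompactSpace G]
  [MeasurableSpace G] [BorelSpace G] [SecondCountableTopology G]
variable (ρ : G →* Matrix (Fin N) (Fin N) ℂ) {z : G} {π : Fin d → Site d →+ ZMod 2}

/-- ★★ **The cut-loop `R_link` block of a twisted covariantly link-RP state is PSD up to the sign
`(-1)^{c(p,i)+c(q,i)}`.** `ν` a probability measure with `IsCovariantLinkRP i ν`, `ρ` continuous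
with `ρ z = -1` (`z` central, `z² = 1`), `μ = ν ∘ T⁻¹` for `T = centralTwist (stagTwist π i z)`;
`p_i = q_i = 0`, half-words `O_a : p + e_i → q + e_i` with `Word.zdLinkHalfOK`, real `c`:
`0 ≤ (-1)^{(c(p,i)+c(q,i)).val} · Σ_{ab} c_a c_b ∫ W_p([+e_i]·O_b·[-e_i]·(flip_i O_a)⁻¹) dμ`.
(Entry by entry `∫ … dμ = (-1)^{c(p,i)+c(q,i)} s_a s_b ∫ … dν`, `s_a = (-1)^{C(O_a)}`, and the
`ν`-block is PSD against the vector `(s_a c_a)_a`.) -/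
theorem rLinkCutWordBlock_twisted_nonneg (hπ : IsDualParity (zdUnit d) π)
    (hzc : ∀ g : G, z * g = g * z) (hz2 : z * z = 1) (hρ : Continuous ρ) (hρz : ρ z = -1)
    {ν : Measure (LGConfig d G)} [IsProbabilityMeasure ν] {i : Fin d} (hν : IsCovariantLinkRP i ν)
    {p q : Site d} (hp : p i = 0) (hq : q i = 0) {n : ℕ} (O : Fin n → Word d)
    (hend : ∀ a, Word.endpointZd (p + Pi.single i 1) (O a) = q + Pi.single i 1)
    (hhalf : ∀ a, Word.zdLinkHalfOK i (O a) (p + Pi.single i 1) = true) (c : Fin n → ℝ) :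
    0 ≤ (-1 : ℝ) ^ (stagParity π i (p, i) + stagParity π i (q, i)).val *
      ∑ a, ∑ b, c a * c b * ∫ U, wordLoopZd ρ p
        (Step.fwd i :: (O b ++ Step.bwd i :: Word.reverse ((O a).map (Step.flipAt i)))) U
        ∂(ν.map (centralTwist (stagTwist π i z))) := by
  set ε : ℝ := (-1 : ℝ) ^ (stagParity π i (p, i) + stagParity π i (q, i)).val with hε
  set σ : Fin n → ℝ := fun a => (-1 : ℝ) ^ (twistParityZd π i (p + Pi.single i 1) (O a)).val with hσ
  -- entry by entry
  have hI : ∀ a b, ∫ U, wordLoopZd ρ p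
      (Step.fwd i :: (O b ++ Step.bwd i :: Word.reverse ((O a).map (Step.flipAt i)))) U
        ∂(ν.map (centralTwist (stagTwist π i z))) =
      ε * σ a * σ b * ∫ U, wordLoopZd ρ p
        (Step.fwd i :: (O b ++ Step.bwd i :: Word.reverse ((O a).map (Step.flipAt i)))) U ∂ν := by
    intro a b
    -- signs multiply on `ℤ/2` (the statement of a QCD-side lemma, inlined to avoid a cross-cell import)
    have hadd : ∀ u v : ZMod 2, (-1 : ℝ) ^ (u + v).val = (-1) ^ u.val * (-1) ^ v.val := fun u v => by
      rw [ZMod.val_add, ← neg_one_pow_eq_pow_mod_two, pow_add]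
    rw [integral_wordLoopZd_map_centralTwist ρ hπ hzc hz2 hρ hρz i ν p _,
      twistParityZd_linkCutGlue hπ hp hq (hend a) (hend b), hadd, hadd]
  have h := rLinkCutWordBlock_nonneg_of_zdLinkHalfOK ρ hρ hν hp hq O hend hhalf (fun a => σ a * c a)
  have hεε : ε * ε = 1 := neg_one_pow_val_mul_self _
  have hrew : ε * ∑ a, ∑ b, c a * c b * ∫ U, wordLoopZd ρ p
      (Step.fwd i :: (O b ++ Step.bwd i :: Word.reverse ((O a).map (Step.flipAt i)))) U
        ∂(ν.map (centralTwist (stagTwist π i z))) =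
      ∑ a, ∑ b, σ a * c a * (σ b * c b) * ∫ U, wordLoopZd ρ p
        (Step.fwd i :: (O b ++ Step.bwd i :: Word.reverse ((O a).map (Step.flipAt i)))) U ∂ν := by
    rw [Finset.mul_sum]
    refine Finset.sum_congr rfl fun a _ => ?_
    rw [Finset.mul_sum]
    refine Finset.sum_congr rfl fun b _ => ?_
    rw [hI a b]
    linear_combination (c a * c b * σ a * σ b * ∫ U, wordLoopZd ρ p
      (Step.fwd i :: (O b ++ Step.bwd i :: Word.reverse ((O a).map (Step.flipAt i)))) U ∂ν) * hεε
  rw [hrew]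
  exact h

end Twisted

/-! ## Even-side limit points at `β ≤ 0` -/

section EvenLimit

open Literature.MathematicalPhysics.QuantumLattice (fundamentalRep unitaryFundamentalRep
  continuous_fundamentalRep continuous_unitaryFundamentalRep fundamentalRep_apply
  unitaryFundamentalRep_apply)

variable {G : Type} [Group G] [TopologicalSpace G] [IsTopologicalGroup G] [CompactSpace G]
  [MeasurableSpace G] [BorelSpace G] [SecondCountableTopology G] [T2Space G] [NeZero d]
variable (ρ : G →* Matrix (Fin N) (Fin N) ℂ) {z : G} {π : Fin d → Site d →+ ZMod 2}

/-- ★★ **Even-side limit points at `β ≤ 0`: the cut-loop `R_link` blocks hold up to the sign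
`(-1)^{c(p,i)+c(q,i)}`** (any dual parity `π`). `G : Type` compact Hausdorff second countable, `z`
central with `z² = 1`, `ρ` continuous with `ρ z = -1`; `μ` the limit of the torus Wilson states at
`β ≤ 0` along a strictly increasing sequence of EVEN sizes. -/
theorem rLinkCutWordBlock_twisted_nonneg_of_isInfiniteVolumeLimitAlong_even
    (hπ : IsDualParity (zdUnit d) π) (hρ : Continuous ρ) (hzc : ∀ g : G, z * g = g * z)
    (hz2 : z * z = 1) (hρz : ρ z = -1) {β : ℝ} (hβ : β ≤ 0) {Lk : ℕ → ℕ} (hmono : StrictMono Lk)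
    (heven : ∀ k, 2 ∣ Lk k + 1) {μ : Measure (LGConfig d G)} (hμ : IsInfiniteVolumeLimitAlong ρ β Lk μ)
    (i : Fin d) {p q : Site d} (hp : p i = 0) (hq : q i = 0) {n : ℕ} (O : Fin n → Word d)
    (hend : ∀ a, Word.endpointZd (p + Pi.single i 1) (O a) = q + Pi.single i 1)
    (hhalf : ∀ a, Word.zdLinkHalfOK i (O a) (p + Pi.single i 1) = true) (c : Fin n → ℝ) :
    0 ≤ (-1 : ℝ) ^ (stagParity π i (p, i) + stagParity π i (q, i)).val *
      ∑ a, ∑ b, c a * c b * ∫ U, wordLoopZd ρ p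
        (Step.fwd i :: (O b ++ Step.bwd i :: Word.reverse ((O a).map (Step.flipAt i)))) U ∂μ := by
  set T := centralTwist (stagTwist π i z) with hT
  have hν : IsInfiniteVolumeLimitAlong ρ (-β) Lk (μ.map T) :=
    hμ.map_centralTwist ρ hπ i hρ hzc hz2 hρz heven
  have hνmem : μ.map T ∈ infiniteVolumeLimitPoints (d := d) ρ (-β) := ⟨Lk, hmono, hν⟩
  haveI : IsProbabilityMeasure (μ.map T) := hν.1
  have hcov : IsCovariantLinkRP i (μ.map T) :=
    covariantLinkRP_of_mem_infiniteVolumeLimitPoints ρ hρ (by linarith) hνmem i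
  have hμeq : μ = (μ.map T).map T :=
    eq_map_centralTwist_map_centralTwist (isStaggering_stagTwist hπ i hzc hz2) μ
  rw [hμeq]
  exact rLinkCutWordBlock_twisted_nonneg ρ hπ hzc hz2 hρ hρz hcov hp hq O hend hhalf c

omit [SecondCountableTopology G] [T2Space G] [NeZero d] in
/-- **The sign in coordinates**: with the coordinate parities,
`c(p,i) + c(q,i) = Σ_{m ≠ i} p_m + Σ_{m ≠ i} q_m (mod 2)`. -/
theorem stagParity_add_stagParity_eq_intCast (hπ : IsDualParity (zdUnit d) π) (i : Fin d)
    (p q : Site d) :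
    stagParity π i (p, i) + stagParity π i (q, i) =
      ((∑ m ∈ Finset.univ.filter (· ≠ i), (p m + q m) : ℤ) : ZMod 2) := by
  rw [stagParity_self_eq_sum hπ, stagParity_self_eq_sum hπ, Int.cast_sum, ← Finset.sum_add_distrib]
  exact Finset.sum_congr rfl fun m _ => by push_cast; ring

/-- ★★★ **The cut-loop `R_link` blocks of even-side limit points at `β ≤ 0`, signed by the
transverse parities.** `G : Type` compact Hausdorff second countable, `z` central with `z² = 1`,
`ρ` continuous with `ρ z = -1` (`SU(2)`, `SU(2n)`, `U(N)` fundamental), `β ≤ 0`, `μ` the limit of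
the torus Wilson states along a strictly increasing sequence of EVEN sizes. For every axis `i`,
sites `p, q` with `p_i = q_i = 0`, half-words `O_a : p + e_i → q + e_i` with `Word.zdLinkHalfOK`
and real `c`:
`0 ≤ (-1)^{(Σ_{m≠i} (p_m + q_m)) mod 2} · Σ_{ab} c_a c_b ∫ W_p([+e_i]·O_b·[-e_i]·(flip_i O_a)⁻¹) dμ`. -/
theorem rLinkCutWordBlock_signed_nonneg_of_isInfiniteVolumeLimitAlong_even (hρ : Continuous ρ)
    (hzc : ∀ g : G, z * g = g * z) (hz2 : z * z = 1) (hρz : ρ z = -1) {β : ℝ} (hβ : β ≤ 0)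
    {Lk : ℕ → ℕ} (hmono : StrictMono Lk) (heven : ∀ k, 2 ∣ Lk k + 1) {μ : Measure (LGConfig d G)}
    (hμ : IsInfiniteVolumeLimitAlong ρ β Lk μ) (i : Fin d) {p q : Site d} (hp : p i = 0)
    (hq : q i = 0) {n : ℕ} (O : Fin n → Word d)
    (hend : ∀ a, Word.endpointZd (p + Pi.single i 1) (O a) = q + Pi.single i 1)
    (hhalf : ∀ a, Word.zdLinkHalfOK i (O a) (p + Pi.single i 1) = true) (c : Fin n → ℝ) :
    0 ≤ (-1 : ℝ) ^ (((∑ m ∈ Finset.univ.filter (· ≠ i), (p m + q m) : ℤ) : ZMod 2)).val *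
      ∑ a, ∑ b, c a * c b * ∫ U, wordLoopZd ρ p
        (Step.fwd i :: (O b ++ Step.bwd i :: Word.reverse ((O a).map (Step.flipAt i)))) U ∂μ := by
  obtain ⟨π, hπ⟩ := exists_isDualParity_zdUnit d
  rw [← stagParity_add_stagParity_eq_intCast hπ]
  exact rLinkCutWordBlock_twisted_nonneg_of_isInfiniteVolumeLimitAlong_even ρ hπ hρ hzc hz2 hρz hβ
    hmono heven hμ i hp hq O hend hhalf c

/-- ★★★ **Equal transverse parities: the cut-loop block IS positive semidefinite at `β ≤ 0`**
(`Σ_{m≠i} (p_m + q_m)` even; even-side limit points, `ρ z = -1`). -/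
theorem rLinkCutWordBlock_nonneg_of_isInfiniteVolumeLimitAlong_even_of_even (hρ : Continuous ρ)
    (hzc : ∀ g : G, z * g = g * z) (hz2 : z * z = 1) (hρz : ρ z = -1) {β : ℝ} (hβ : β ≤ 0)
    {Lk : ℕ → ℕ} (hmono : StrictMono Lk) (heven : ∀ k, 2 ∣ Lk k + 1) {μ : Measure (LGConfig d G)}
    (hμ : IsInfiniteVolumeLimitAlong ρ β Lk μ) (i : Fin d) {p q : Site d} (hp : p i = 0)
    (hq : q i = 0) (hpq : Even (∑ m ∈ Finset.univ.filter (· ≠ i), (p m + q m))) {n : ℕ}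
    (O : Fin n → Word d) (hend : ∀ a, Word.endpointZd (p + Pi.single i 1) (O a) = q + Pi.single i 1)
    (hhalf : ∀ a, Word.zdLinkHalfOK i (O a) (p + Pi.single i 1) = true) (c : Fin n → ℝ) :
    0 ≤ ∑ a, ∑ b, c a * c b * ∫ U, wordLoopZd ρ p
        (Step.fwd i :: (O b ++ Step.bwd i :: Word.reverse ((O a).map (Step.flipAt i)))) U ∂μ := by
  have h := rLinkCutWordBlock_signed_nonneg_of_isInfiniteVolumeLimitAlong_even ρ hρ hzc hz2 hρz hβ
    hmono heven hμ i hp hq O hend hhalf c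
  rwa [ZMod.intCast_eq_zero_iff_even.2 hpq, ZMod.val_zero, pow_zero, one_mul] at h

/-- ★★★ **Opposite transverse parities: the cut-loop block is NEGATIVE semidefinite at `β ≤ 0`**
(`Σ_{m≠i} (p_m + q_m)` odd; even-side limit points, `ρ z = -1`). -/
theorem rLinkCutWordBlock_nonpos_of_isInfiniteVolumeLimitAlong_even_of_odd (hρ : Continuous ρ)
    (hzc : ∀ g : G, z * g = g * z) (hz2 : z * z = 1) (hρz : ρ z = -1) {β : ℝ} (hβ : β ≤ 0)
    {Lk : ℕ → ℕ} (hmono : StrictMono Lk) (heven : ∀ k, 2 ∣ Lk k + 1) {μ : Measure (LGConfig d G)}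
    (hμ : IsInfiniteVolumeLimitAlong ρ β Lk μ) (i : Fin d) {p q : Site d} (hp : p i = 0)
    (hq : q i = 0) (hpq : Odd (∑ m ∈ Finset.univ.filter (· ≠ i), (p m + q m))) {n : ℕ}
    (O : Fin n → Word d) (hend : ∀ a, Word.endpointZd (p + Pi.single i 1) (O a) = q + Pi.single i 1)
    (hhalf : ∀ a, Word.zdLinkHalfOK i (O a) (p + Pi.single i 1) = true) (c : Fin n → ℝ) :
    ∑ a, ∑ b, c a * c b * ∫ U, wordLoopZd ρ p
        (Step.fwd i :: (O b ++ Step.bwd i :: Word.reverse ((O a).map (Step.flipAt i)))) U ∂μ ≤ 0 := by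
  have h := rLinkCutWordBlock_signed_nonneg_of_isInfiniteVolumeLimitAlong_even ρ hρ hzc hz2 hρz hβ
    hmono heven hμ i hp hq O hend hhalf c
  have h1 : (((∑ m ∈ Finset.univ.filter (· ≠ i), (p m + q m) : ℤ) : ZMod 2)).val = 1 := by
    rw [ZMod.intCast_eq_one_iff_odd.2 hpq]; rfl
  rw [h1, pow_one] at h
  linarith

/-- **The `1 × 1` block of `O = [+e_k]` (`q = p + e_k`, opposite parity) is the plaquette:
`∫ W_p(P_{ik}) dμ ≤ 0`** for even-side limit points at `β ≤ 0` (`ρ z = -1`) — consistent with the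
DLR sign rule (`CovariantLinkRPNegativeCoupling.lean`). -/
theorem integral_wordLoopZd_plaquette_nonpos_of_isInfiniteVolumeLimitAlong_even (hρ : Continuous ρ)
    (hzc : ∀ g : G, z * g = g * z) (hz2 : z * z = 1) (hρz : ρ z = -1) {β : ℝ} (hβ : β ≤ 0)
    {Lk : ℕ → ℕ} (hmono : StrictMono Lk) (heven : ∀ k, 2 ∣ Lk k + 1) {μ : Measure (LGConfig d G)}
    (hμ : IsInfiniteVolumeLimitAlong ρ β Lk μ) {i : Fin d} {p : Site d} (hp : p i = 0) {k : Fin d}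
    (hk : k ≠ i) :
    ∫ U, wordLoopZd ρ p (Word.plaquette i k) U ∂μ ≤ 0 := by
  have hq : (p + Pi.single k 1 : Site d) i = 0 := by
    simp [Pi.single_eq_of_ne (Ne.symm hk), hp]
  have hend : ∀ a : Fin 1, Word.endpointZd (p + Pi.single i 1) ((fun _ => [Step.fwd k]) a) =
      (p + Pi.single k 1) + Pi.single i 1 := fun _ => by
    simp only [Word.endpointZd_cons, Word.endpointZd_nil, Step.applyZd_fwd]
    abel
  have hhalf : ∀ a : Fin 1, Word.zdLinkHalfOK i ((fun _ => [Step.fwd k]) a) (p + Pi.single i 1) = true :=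
    fun _ => Word.zdLinkHalfOK_halfPlaquette k (by simp [hp])
  have hodd : Odd (∑ m ∈ Finset.univ.filter (· ≠ i), (p m + (p + Pi.single k 1 : Site d) m)) := by
    have hsum : ∑ m ∈ Finset.univ.filter (· ≠ i), (p m + (p + Pi.single k 1 : Site d) m) =
        2 * (∑ m ∈ Finset.univ.filter (· ≠ i), p m) + 1 := by
      have hk' : k ∈ Finset.univ.filter (· ≠ i) := Finset.mem_filter.2 ⟨Finset.mem_univ _, hk⟩
      simp only [Pi.add_apply]
      rw [Finset.sum_add_distrib, Finset.sum_add_distrib, Finset.sum_pi_single' k (1 : ℤ), if_pos hk']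
      ring
    rw [hsum]
    exact odd_two_mul_add_one _
  have h := rLinkCutWordBlock_nonpos_of_isInfiniteVolumeLimitAlong_even_of_odd ρ hρ hzc hz2 hρz hβ
    hmono heven hμ i hp hq hodd (fun _ : Fin 1 => [Step.fwd k]) hend hhalf (fun _ => 1)
  rw [Fin.sum_univ_one, Fin.sum_univ_one, one_mul, one_mul, linkCutGlue_halfPlaquette hk] at h
  exact h

/-- ★★★ **`SU(2n)` (`2n ≥ 2`), every `d ≥ 1`, `β ≤ 0`**: the signed cut-loop `R_link` blocks of the
even-side limit points of lattice `SU(2n)` Yang–Mills (fundamental Wilson action). -/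
theorem rLinkCutWordBlock_signed_nonneg_of_isInfiniteVolumeLimitAlong_even_suEven {M : ℕ}
    (hM : Even M) {β : ℝ} (hβ : β ≤ 0) {Lk : ℕ → ℕ} (hmono : StrictMono Lk)
    (heven : ∀ k, 2 ∣ Lk k + 1) {μ : Measure (LGConfig d (Matrix.specialUnitaryGroup (Fin M) ℂ))}
    (hμ : IsInfiniteVolumeLimitAlong (fundamentalRep (Fin M)) β Lk μ) (i : Fin d) {p q : Site d}
    (hp : p i = 0) (hq : q i = 0) {n : ℕ} (O : Fin n → Word d)
    (hend : ∀ a, Word.endpointZd (p + Pi.single i 1) (O a) = q + Pi.single i 1)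
    (hhalf : ∀ a, Word.zdLinkHalfOK i (O a) (p + Pi.single i 1) = true) (c : Fin n → ℝ) :
    0 ≤ (-1 : ℝ) ^ (((∑ m ∈ Finset.univ.filter (· ≠ i), (p m + q m) : ℤ) : ZMod 2)).val *
      ∑ a, ∑ b, c a * c b * ∫ U, wordLoopZd (fundamentalRep (Fin M)) p
        (Step.fwd i :: (O b ++ Step.bwd i :: Word.reverse ((O a).map (Step.flipAt i)))) U ∂μ := by
  haveI : SecondCountableTopology (Matrix (Fin M) (Fin M) ℂ) :=
    inferInstanceAs (SecondCountableTopology (Fin M → Fin M → ℂ))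
  haveI : SecondCountableTopology (Matrix.specialUnitaryGroup (Fin M) ℂ) :=
    Topology.IsEmbedding.subtypeVal.secondCountableTopology
  set w : Matrix.specialUnitaryGroup (Fin M) ℂ :=
    ⟨-1, neg_one_mem_specialUnitaryGroup_of_even hM⟩ with hw
  refine rLinkCutWordBlock_signed_nonneg_of_isInfiniteVolumeLimitAlong_even (fundamentalRep (Fin M))
    (continuous_fundamentalRep (Fin M)) (z := w) (fun g => ?_) ?_ ?_ hβ hmono heven hμ i hp hq O hend
    hhalf c
  · exact Subtype.ext (by simp [hw])
  · exact Subtype.ext (by simp [hw])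
  · rw [fundamentalRep_apply]

/-- ★★★ **`U(N)`, every `d ≥ 1`, `β ≤ 0`**: the signed cut-loop `R_link` blocks of the even-side
limit points of lattice `U(N)` gauge theory (fundamental Wilson action; `z = -1 ∈ U(N)`). -/
theorem rLinkCutWordBlock_signed_nonneg_of_isInfiniteVolumeLimitAlong_even_uN {M : ℕ}
    {β : ℝ} (hβ : β ≤ 0) {Lk : ℕ → ℕ} (hmono : StrictMono Lk)
    (heven : ∀ k, 2 ∣ Lk k + 1) {μ : Measure (LGConfig d (Matrix.unitaryGroup (Fin M) ℂ))}
    (hμ : IsInfiniteVolumeLimitAlong (unitaryFundamentalRep (Fin M) ℂ) β Lk μ) (i : Fin d)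
    {p q : Site d} (hp : p i = 0) (hq : q i = 0) {n : ℕ} (O : Fin n → Word d)
    (hend : ∀ a, Word.endpointZd (p + Pi.single i 1) (O a) = q + Pi.single i 1)
    (hhalf : ∀ a, Word.zdLinkHalfOK i (O a) (p + Pi.single i 1) = true) (c : Fin n → ℝ) :
    0 ≤ (-1 : ℝ) ^ (((∑ m ∈ Finset.univ.filter (· ≠ i), (p m + q m) : ℤ) : ZMod 2)).val *
      ∑ a, ∑ b, c a * c b * ∫ U, wordLoopZd (unitaryFundamentalRep (Fin M) ℂ) p
        (Step.fwd i :: (O b ++ Step.bwd i :: Word.reverse ((O a).map (Step.flipAt i)))) U ∂μ := by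
  haveI : SecondCountableTopology (Matrix (Fin M) (Fin M) ℂ) :=
    inferInstanceAs (SecondCountableTopology (Fin M → Fin M → ℂ))
  haveI : SecondCountableTopology (Matrix.unitaryGroup (Fin M) ℂ) :=
    Topology.IsEmbedding.subtypeVal.secondCountableTopology
  refine rLinkCutWordBlock_signed_nonneg_of_isInfiniteVolumeLimitAlong_even
    (unitaryFundamentalRep (Fin M) ℂ) (continuous_unitaryFundamentalRep (n := Fin M) (𝕜 := ℂ))
    (z := -1) (fun g => ?_) ?_ ?_ hβ hmono heven hμ i hp hq O hend hhalf c
  · rw [neg_one_mul, mul_neg_one]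
  · rw [neg_one_mul, neg_neg]
  · rw [unitaryFundamentalRep_apply, Unitary.coe_neg, OneMemClass.coe_one]

end EvenLimit

end TiltedRP

end Summit.QuantumFields.GaugeBoot
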